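import Literature.NumberTheory.Transcendental.KZProductIdeal
import HarnessLib

/-!
# Peeling the unit ball in the Kontsevich–Zagier calculus: `B_{n+d} ∼ B_n × B_d` by one move

Generic, fully proved move lemmas (Kontsevich–Zagier 2001, §1.2 rule (2)) for representations
PINNED by domain and integrand. With `B_n = {z ∈ ℝⁿ | ∑ zᵢ² < 1}` the open unit ball and
`λ(z') = √(1 − |z'|²)`:

* `KZ.BallPeeling.isSemialgebraic_ball`, `exists_ballRep` — `B_n` is `ℚ`-semialgebraic and the
  representations `[B_n, (1 − |z|²)^e]` (`e ∈ ℕ`) exist;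
* `KZ.BallPeeling.exists_peelChart` — the peeling chart `Φ(z', w) = (z', λ(z') w)` of `ℝⁿ⁺ᵈ`
  (first block `Fin.castAdd`, second block `Fin.natAdd`, the conventions of `IntegralRep.prod`),
  its derivative (block lower-triangular, `det = λ(z')ᵈ`), and
  `isSemialgebraicMapOn_peel` / `injOn_peel` / `image_peel` (`Φ(B_n × B_d) = B_{n+d}`) /
  `one_sub_normSq_peel` (`1 − |Φ(z',w)|² = (1 − |z'|²)(1 − |w|²)`);
* `KZ.BallPeeling.peel_equivalent` — THE ENGINE: for every real `β`,
  `[B_{n+d}, (1 − |z|²)^β] ∼ [B_n, (1 − |z'|²)^{β + d/2}] × [B_d, (1 − |w|²)^β]`, ONE change of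
  variables along `Φ` on the product domain;
* `KZ.BallPeeling.peelTwo_equivalent` — `d = 2`, natural exponents:
  `[B_{2m+2}, (1 − |z|²)^e] ∼ [B_{2m}, (1 − |z'|²)^{e+1}] × [disc, (1 − |w|²)^e]`
  (iterating: `vol B_{2k} = π^k / k!` inside the rules);
* `KZ.BallPeeling.discToSquare_equivalent` — `n = d = 1`:
  `[disc, (1 − |w|²)^e] ∼ [(−1,1), (1 − x²)^{e + 1/2}] × [(−1,1), (1 − s²)^e]`.

The symmetric-Beta fold `[(−1,1), (1 − x²)^γ] ∼ [(0,1), t^{−1/2} (1 − t)^γ]` is the companion file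
`KZBallPeelingAux.lean`. Everything is proved; no `def`, no named fact.
-/

noncomputable section

open MeasureTheory Set
open Literature.ModelTheory.ExponentialFields (IsSemialgebraic isSemialgebraic_setOf_eval_pos)
open MvPolynomial (aeval X C)

namespace Literature.NumberTheory.Transcendental

namespace KZ

namespace BallPeeling

/-! ## The unit ball -/

/-- The open unit ball `{∑ zᵢ² < 1} ⊆ ℝⁿ` is `ℚ`-semialgebraic. [folklore] -/
theorem isSemialgebraic_ball (n : ℕ) :
    IsSemialgebraic ℚ {z : Fin n → ℝ | ∑ i, (z i) ^ 2 < 1} := by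
  convert isSemialgebraic_setOf_eval_pos (k := ℚ) (R := ℝ)
    (1 - ∑ i, (X i : MvPolynomial (Fin n) ℚ) ^ 2) using 1
  ext z
  simp [sub_pos]

/-- **`[B_n, (1 − |z|²)^e]` exists** (`e ∈ ℕ`): the ball is `ℚ`-semialgebraic, the integrand is a
`ℚ`-polynomial, integrable as a continuous function on the compact cube `[−1,1]ⁿ ⊇ B_n`.
[cite: KontsevichZagier2001, §1.1] -/
theorem exists_ballRep (n e : ℕ) :
    ∃ r : IntegralRep n, r.domain = {z | ∑ i, (z i) ^ 2 < 1} ∧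
      r.integrand = fun z => (1 - ∑ i, (z i) ^ 2) ^ e := by
  have hsa : IsSemialgebraicFunOn ℚ {z : Fin n → ℝ | ∑ i, (z i) ^ 2 < 1}
      (fun z => (1 - ∑ i, (z i) ^ 2) ^ e) :=
    (isSemialgebraicFunOn_aeval (isSemialgebraic_ball n)
      ((1 - ∑ i, (X i : MvPolynomial (Fin n) ℚ) ^ 2) ^ e)).congr fun z _ => by simp
  have hK : IsCompact (Set.pi univ fun _ : Fin n => Set.Icc (-1:ℝ) 1) :=
    isCompact_univ_pi fun _ => isCompact_Icc
  have hcont : Continuous fun z : Fin n → ℝ => (1 - ∑ i, (z i) ^ 2) ^ e :=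
    (continuous_const.sub (continuous_finsetSum _ fun i _ => (continuous_apply i).pow 2)).pow e
  have hint : IntegrableOn (fun z : Fin n → ℝ => (1 - ∑ i, (z i) ^ 2) ^ e)
      {z | ∑ i, (z i) ^ 2 < 1} := by
    refine (hcont.continuousOn.integrableOn_compact hK).mono_set fun z hz => ?_
    have hz' : ∑ i, (z i) ^ 2 < 1 := hz
    simp only [mem_univ_pi, mem_Icc]
    intro i
    have hi : (z i) ^ 2 ≤ ∑ j, (z j) ^ 2 :=
      Finset.single_le_sum (fun j _ => sq_nonneg (z j)) (Finset.mem_univ i)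
    exact abs_le.1 ((sq_le_one_iff_abs_le_one (z i)).1 (by linarith))
  exact ⟨⟨_, _, isSemialgebraic_ball n, hsa, hint⟩, rfl, rfl⟩

/-- The interval `(−1,1) ⊆ ℝ¹` is the unit ball `B_1`. [folklore] -/
theorem setOf_apply_mem_Ioo_eq_ball :
    {x : Fin 1 → ℝ | x 0 ∈ Set.Ioo (-1:ℝ) 1} = {z : Fin 1 → ℝ | ∑ i, (z i) ^ 2 < 1} := by
  ext x
  simp only [mem_setOf_eq, Fin.sum_univ_one, mem_Ioo, sq_lt_one_iff_abs_lt_one, abs_lt]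

/-! ## The peeling chart `Φ(z', w) = (z', √(1 − |z'|²) · w)` -/

/-- **The peeling chart.** On `ℝⁿ⁺ᵈ ∋ z = (z', w)` (`z' = z ∘ castAdd`, `w = z ∘ natAdd`) the map
`Φ(z', w) = (z', λ(z') w)`, `λ(z') = √(1 − |z'|²)`, has at every point with `|z'|² < 1` a
derivative whose matrix is block lower-triangular `[[1, 0], [∗, λ · 1]]`, of determinant `λᵈ`.
[folklore] -/
theorem exists_peelChart (n d : ℕ) :
    ∃ (Φ : (Fin (n + d) → ℝ) → (Fin (n + d) → ℝ))
      (Φ' : (Fin (n + d) → ℝ) → (Fin (n + d) → ℝ) →L[ℝ] (Fin (n + d) → ℝ)),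
      (∀ z i, Φ z (Fin.castAdd d i) = z (Fin.castAdd d i)) ∧
      (∀ z j, Φ z (Fin.natAdd n j) =
        √(1 - ∑ i, (z (Fin.castAdd d i)) ^ 2) * z (Fin.natAdd n j)) ∧
      (∀ z, ∑ i, (z (Fin.castAdd d i)) ^ 2 < 1 → HasFDerivAt Φ (Φ' z) z) ∧
      (∀ z, (Φ' z).det = (√(1 - ∑ i, (z (Fin.castAdd d i)) ^ 2)) ^ d) := by
  set lam : (Fin (n + d) → ℝ) → ℝ := fun z => √(1 - ∑ i, (z (Fin.castAdd d i)) ^ 2) with hlam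
  set Φ : (Fin (n + d) → ℝ) → (Fin (n + d) → ℝ) := fun z =>
    Fin.append (fun i => z (Fin.castAdd d i)) (fun j => lam z * z (Fin.natAdd n j)) with hΦ
  set Mb : (Fin (n + d) → ℝ) → Matrix (Fin n ⊕ Fin d) (Fin n ⊕ Fin d) ℝ := fun z =>
    Matrix.fromBlocks 1 0 (Matrix.of fun j i => -(z (Fin.natAdd n j) * z (Fin.castAdd d i)) / lam z)
      (lam z • (1 : Matrix (Fin d) (Fin d) ℝ)) with hMb
  set Φ' : (Fin (n + d) → ℝ) → (Fin (n + d) → ℝ) →L[ℝ] (Fin (n + d) → ℝ) := fun z =>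
    LinearMap.toContinuousLinearMap
      (Matrix.toLin' (Matrix.reindex finSumFinEquiv finSumFinEquiv (Mb z))) with hΦ'
  have hΦ1 : ∀ z i, Φ z (Fin.castAdd d i) = z (Fin.castAdd d i) := fun z i => by simp [hΦ]
  have hΦ2 : ∀ z j, Φ z (Fin.natAdd n j) = lam z * z (Fin.natAdd n j) := fun z j => by simp [hΦ]
  have hrow : ∀ z v a, Φ' z v a =
      ∑ b, (Matrix.reindex finSumFinEquiv finSumFinEquiv (Mb z)) a b * v b := by
    intro z v a
    change Matrix.toLin' _ v a = _
    rw [Matrix.toLin'_apply]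
    rfl
  have hL1 : ∀ z v i, Φ' z v (Fin.castAdd d i) = v (Fin.castAdd d i) := by
    intro z v i
    rw [hrow, Fin.sum_univ_add]
    simp [hMb, Matrix.one_apply]
  have hL2 : ∀ z v j, Φ' z v (Fin.natAdd n j) =
      (∑ i, -(z (Fin.natAdd n j) * z (Fin.castAdd d i)) / lam z * v (Fin.castAdd d i)) +
        lam z * v (Fin.natAdd n j) := by
    intro z v j
    rw [hrow, Fin.sum_univ_add]
    simp [hMb, Matrix.one_apply]
  have hdet : ∀ z, (Φ' z).det = lam z ^ d := by
    intro z
    change LinearMap.det (Matrix.toLin' (Matrix.reindex finSumFinEquiv finSumFinEquiv (Mb z))) = _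
    rw [LinearMap.det_toLin', Matrix.det_reindex_self, hMb, Matrix.det_fromBlocks_zero₁₂,
      Matrix.det_one, one_mul, Matrix.det_smul, Matrix.det_one, mul_one, Fintype.card_fin]
  refine ⟨Φ, Φ', hΦ1, hΦ2, fun z hz => ?_, hdet⟩
  have hpos : 0 < 1 - ∑ i, (z (Fin.castAdd d i)) ^ 2 := sub_pos.2 hz
  have hsq : ∀ i : Fin n, HasFDerivAt (fun y : Fin (n + d) → ℝ => y (Fin.castAdd d i) ^ 2)
      ((2 * z (Fin.castAdd d i)) •
        ContinuousLinearMap.proj (R := ℝ) (φ := fun _ : Fin (n + d) => ℝ) (Fin.castAdd d i)) z := by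
    intro i
    refine ((hasFDerivAt_apply (𝕜 := ℝ) (Fin.castAdd d i) z).pow 2).congr_fderiv ?_
    ext v
    simp
  have hu : HasFDerivAt (fun y : Fin (n + d) → ℝ => 1 - ∑ i, y (Fin.castAdd d i) ^ 2)
      (-(∑ i, (2 * z (Fin.castAdd d i)) •
        ContinuousLinearMap.proj (R := ℝ) (φ := fun _ : Fin (n + d) => ℝ) (Fin.castAdd d i))) z :=
    (HasFDerivAt.fun_sum fun i _ => hsq i).const_sub 1
  have hl := hu.sqrt hpos.ne'
  refine hasFDerivAt_pi'' fun a => ?_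
  induction a using Fin.addCases with
  | left i =>
    have hf : (fun y => Φ y (Fin.castAdd d i)) = fun y => y (Fin.castAdd d i) :=
      funext fun y => hΦ1 y i
    rw [hf]
    refine (hasFDerivAt_apply (Fin.castAdd d i) z).congr_fderiv
      (ContinuousLinearMap.ext fun v => ?_)
    simp [hL1]
  | right j =>
    have hf : (fun y => Φ y (Fin.natAdd n j)) = fun y => lam y * y (Fin.natAdd n j) :=
      funext fun y => hΦ2 y j
    rw [hf]
    refine (hl.mul (hasFDerivAt_apply (Fin.natAdd n j) z)).congr_fderiv
      (ContinuousLinearMap.ext fun v => ?_)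
    simp [hL2]
    rw [add_comm, Finset.mul_sum, Finset.mul_sum, ← Finset.sum_neg_distrib]
    congr 1
    refine Finset.sum_congr rfl fun i _ => ?_
    simp only [hlam]
    ring

/-- The peeling chart is a `ℚ`-semialgebraic map on every `ℚ`-semialgebraic set (coordinates:
polynomials, and `√(polynomial) · polynomial`). [folklore] -/
theorem isSemialgebraicMapOn_peel {n d : ℕ} (Φ : (Fin (n + d) → ℝ) → (Fin (n + d) → ℝ))
    (hΦ1 : ∀ z i, Φ z (Fin.castAdd d i) = z (Fin.castAdd d i))
    (hΦ2 : ∀ z j, Φ z (Fin.natAdd n j) =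
      √(1 - ∑ i, (z (Fin.castAdd d i)) ^ 2) * z (Fin.natAdd n j))
    {s : Set (Fin (n + d) → ℝ)} (hs : IsSemialgebraic ℚ s) : IsSemialgebraicMapOn ℚ s Φ := by
  refine IsSemialgebraicMapOn.of_forall hs fun a => ?_
  induction a using Fin.addCases with
  | left i =>
    exact (isSemialgebraicFunOn_aeval hs (X (Fin.castAdd d i))).congr fun z _ => by simp [hΦ1]
  | right j =>
    have h1 : IsSemialgebraicFunOn ℚ s (fun z => √(aeval z
        (1 - ∑ i, (X (Fin.castAdd d i) : MvPolynomial (Fin (n + d)) ℚ) ^ 2))) :=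
      IsSemialgebraicFunOn.sqrt_holds (isSemialgebraicFunOn_aeval hs _)
    refine (IsSemialgebraicFunOn.mul_holds h1
      (isSemialgebraicFunOn_aeval hs (X (Fin.natAdd n j)))).congr fun z _ => ?_
    simp [hΦ2]

/-- The peeling chart is injective where `|z'|² < 1` (there `λ(z') > 0`). [folklore] -/
theorem injOn_peel {n d : ℕ} (Φ : (Fin (n + d) → ℝ) → (Fin (n + d) → ℝ))
    (hΦ1 : ∀ z i, Φ z (Fin.castAdd d i) = z (Fin.castAdd d i))
    (hΦ2 : ∀ z j, Φ z (Fin.natAdd n j) =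
      √(1 - ∑ i, (z (Fin.castAdd d i)) ^ 2) * z (Fin.natAdd n j)) :
    Set.InjOn Φ {z | ∑ i, (z (Fin.castAdd d i)) ^ 2 < 1} := by
  intro x hx y _ hxy
  have h1 : ∀ i, x (Fin.castAdd d i) = y (Fin.castAdd d i) := fun i => by
    rw [← hΦ1 x i, ← hΦ1 y i, hxy]
  have hl : √(1 - ∑ i, (y (Fin.castAdd d i)) ^ 2) = √(1 - ∑ i, (x (Fin.castAdd d i)) ^ 2) := by
    simp only [h1]
  have hpos : 0 < √(1 - ∑ i, (x (Fin.castAdd d i)) ^ 2) := Real.sqrt_pos.2 (sub_pos.2 hx)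
  funext a
  induction a using Fin.addCases with
  | left i => exact h1 i
  | right j =>
    have h := congrFun hxy (Fin.natAdd n j)
    rw [hΦ2, hΦ2, hl] at h
    exact mul_left_cancel₀ hpos.ne' h

/-- `1 − |Φ(z', w)|² = (1 − |z'|²)(1 − |w|²)` for `|z'|² ≤ 1`. [folklore] -/
theorem one_sub_normSq_peel {n d : ℕ} (Φ : (Fin (n + d) → ℝ) → (Fin (n + d) → ℝ))
    (hΦ1 : ∀ z i, Φ z (Fin.castAdd d i) = z (Fin.castAdd d i))
    (hΦ2 : ∀ z j, Φ z (Fin.natAdd n j) =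
      √(1 - ∑ i, (z (Fin.castAdd d i)) ^ 2) * z (Fin.natAdd n j))
    (z : Fin (n + d) → ℝ) (hz : ∑ i, (z (Fin.castAdd d i)) ^ 2 ≤ 1) :
    1 - ∑ a, (Φ z a) ^ 2 =
      (1 - ∑ i, (z (Fin.castAdd d i)) ^ 2) * (1 - ∑ j, (z (Fin.natAdd n j)) ^ 2) := by
  rw [Fin.sum_univ_add]
  simp only [hΦ1, hΦ2, mul_pow, ← Finset.mul_sum]
  rw [Real.sq_sqrt (sub_nonneg.2 hz)]
  ring

/-- **The peeling chart maps `B_n × B_d` ONTO `B_{n+d}`** (inverse: `w = z'' / λ(z')`).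
[folklore] -/
theorem image_peel {n d : ℕ} (Φ : (Fin (n + d) → ℝ) → (Fin (n + d) → ℝ))
    (hΦ1 : ∀ z i, Φ z (Fin.castAdd d i) = z (Fin.castAdd d i))
    (hΦ2 : ∀ z j, Φ z (Fin.natAdd n j) =
      √(1 - ∑ i, (z (Fin.castAdd d i)) ^ 2) * z (Fin.natAdd n j)) :
    Φ '' {z | ∑ i, (z (Fin.castAdd d i)) ^ 2 < 1 ∧ ∑ j, (z (Fin.natAdd n j)) ^ 2 < 1} =
      {y | ∑ a, (y a) ^ 2 < 1} := by
  ext y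
  constructor
  · rintro ⟨z, ⟨hA, hB⟩, rfl⟩
    have h := one_sub_normSq_peel Φ hΦ1 hΦ2 z hA.le
    have hprod : 0 < (1 - ∑ i, (z (Fin.castAdd d i)) ^ 2) * (1 - ∑ j, (z (Fin.natAdd n j)) ^ 2) :=
      mul_pos (sub_pos.2 hA) (sub_pos.2 hB)
    show ∑ a, (Φ z a) ^ 2 < 1
    linarith
  · intro hy
    have hy' : ∑ a, (y a) ^ 2 < 1 := hy
    rw [Fin.sum_univ_add] at hy'
    have hB0 : 0 ≤ ∑ j, (y (Fin.natAdd n j)) ^ 2 := Finset.sum_nonneg fun j _ => sq_nonneg _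
    have hA : ∑ i, (y (Fin.castAdd d i)) ^ 2 < 1 := by linarith
    set L : ℝ := √(1 - ∑ i, (y (Fin.castAdd d i)) ^ 2) with hL
    have hLpos : 0 < L := Real.sqrt_pos.2 (sub_pos.2 hA)
    have hL2 : L ^ 2 = 1 - ∑ i, (y (Fin.castAdd d i)) ^ 2 := Real.sq_sqrt (sub_pos.2 hA).le
    refine ⟨Fin.append (fun i => y (Fin.castAdd d i)) (fun j => y (Fin.natAdd n j) / L),
      ⟨?_, ?_⟩, ?_⟩
    · simpa only [mem_setOf_eq, Fin.append_left] using hA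
    · simp only [Fin.append_right, div_pow, ← Finset.sum_div]
      rw [div_lt_one (pow_pos hLpos 2), hL2]
      linarith
    · funext a
      induction a using Fin.addCases with
      | left i => rw [hΦ1, Fin.append_left]
      | right j =>
        rw [hΦ2]
        simp only [Fin.append_left, Fin.append_right]
        rw [← hL]
        field_simp

/-! ## The engine: one change of variables -/

/-- **Peeling the ball (real exponent).** For representations pinned as
`r = [B_{n+d}, (1 − |z|²)^β]`, `p = [B_n, (1 − |z'|²)^{β + d/2}]`, `q = [B_d, (1 − |w|²)^β]`:
`r ∼ p × q`, by ONE change of variables along the peeling chart `Φ(z', w) = (z', √(1−|z'|²) w)`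
on the product domain `B_n × B_d` (`|det DΦ| = (1 − |z'|²)^{d/2}`, image `B_{n+d}`, and
`(1 − |Φ|²)^β · (1−|z'|²)^{d/2} = (1−|z'|²)^{β+d/2} (1−|w|²)^β`).
[cite: KontsevichZagier2001, §1.2 rule (2)] -/
theorem peel_equivalent (n d : ℕ) (β : ℝ) (r : IntegralRep (n + d)) (p : IntegralRep n)
    (q : IntegralRep d)
    (hrd : r.domain = {z | ∑ i, (z i) ^ 2 < 1})
    (hri : Set.EqOn r.integrand (fun z => (1 - ∑ i, (z i) ^ 2) ^ β) r.domain)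
    (hpd : p.domain = {z | ∑ i, (z i) ^ 2 < 1})
    (hpi : Set.EqOn p.integrand (fun z => (1 - ∑ i, (z i) ^ 2) ^ (β + (d : ℝ) / 2)) p.domain)
    (hqd : q.domain = {w | ∑ i, (w i) ^ 2 < 1})
    (hqi : Set.EqOn q.integrand (fun w => (1 - ∑ i, (w i) ^ 2) ^ β) q.domain) :
    Equivalent r (p.prod q) := by
  obtain ⟨Φ, Φ', hΦ1, hΦ2, hderiv, hdet⟩ := exists_peelChart n d
  have hdom : (p.prod q).domain =
      {z | ∑ i, (z (Fin.castAdd d i)) ^ 2 < 1 ∧ ∑ j, (z (Fin.natAdd n j)) ^ 2 < 1} := by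
    ext z
    simp [IntegralRep.prodDomain, hpd, hqd]
  refine Equivalent.symm (changeOfVariablesRel_subset_relations
    ⟨n + d, p.prod q, r, Φ, Φ', ?_, fun z hz => ?_, ?_, ?_, fun z hz => ?_, rfl⟩)
  · exact isSemialgebraicMapOn_peel Φ hΦ1 hΦ2 (p.prod q).isSemialgebraic_domain
  · rw [hdom] at hz
    exact (hderiv z hz.1).hasFDerivWithinAt
  · rw [hdom]
    exact (injOn_peel Φ hΦ1 hΦ2).mono fun z hz => hz.1
  · rw [hdom, hrd, image_peel Φ hΦ1 hΦ2]
  · have hz' := hz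
    rw [hdom] at hz'
    obtain ⟨hA, hB⟩ := hz'
    have hΦz : Φ z ∈ r.domain := by
      rw [hrd, ← image_peel Φ hΦ1 hΦ2]
      exact mem_image_of_mem Φ ⟨hA, hB⟩
    have hp : (fun i => z (Fin.castAdd d i)) ∈ p.domain := by rw [hpd]; exact hA
    have hq : (fun j => z (Fin.natAdd n j)) ∈ q.domain := by rw [hqd]; exact hB
    have hA' : 0 < 1 - ∑ i, (z (Fin.castAdd d i)) ^ 2 := sub_pos.2 hA
    have hB' : 0 < 1 - ∑ j, (z (Fin.natAdd n j)) ^ 2 := sub_pos.2 hB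
    rw [IntegralRep.prod_integrand_eq, IntegralRep.prodFun_apply, hpi hp, hqi hq, hri hΦz, hdet z]
    dsimp only
    rw [one_sub_normSq_peel Φ hΦ1 hΦ2 z hA.le, abs_of_nonneg (pow_nonneg (Real.sqrt_nonneg _) _),
      Real.mul_rpow hA'.le hB'.le, Real.rpow_add hA', Real.sqrt_eq_rpow, ← Real.rpow_natCast,
      ← Real.rpow_mul hA'.le]
    rw [show (1:ℝ) / 2 * (d : ℝ) = (d : ℝ) / 2 by ring]
    ring

/-! ## Corollaries with natural exponents -/

/-- **Peeling an even-dimensional ball** (`d = 2`, natural exponents): for representations pinned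
as `r = [B_{2m+2}, (1 − |z|²)^e]`, `p = [B_{2m}, (1 − |z'|²)^{e+1}]`, `q = [disc, (1 − |w|²)^e]`:
`r ∼ p × q` (one change of variables `(z', w) ↦ (z', √(1−|z'|²) w)`, `|det| = 1 − |z'|²`).
Iterated from `e = 0` this is `vol B_{2k} = π^k/k!` inside the rules.
[cite: KontsevichZagier2001, §1.2 rule (2)] -/
theorem peelTwo_equivalent (m e : ℕ) (r : IntegralRep (2 * m + 2)) (p : IntegralRep (2 * m))
    (q : IntegralRep 2)
    (hrd : r.domain = {z | ∑ i, (z i) ^ 2 < 1})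
    (hri : Set.EqOn r.integrand (fun z => (1 - ∑ i, (z i) ^ 2) ^ e) r.domain)
    (hpd : p.domain = {z | ∑ i, (z i) ^ 2 < 1})
    (hpi : Set.EqOn p.integrand (fun z => (1 - ∑ i, (z i) ^ 2) ^ (e + 1)) p.domain)
    (hqd : q.domain = {w | ∑ i, (w i) ^ 2 < 1})
    (hqi : Set.EqOn q.integrand (fun w => (1 - ∑ i, (w i) ^ 2) ^ e) q.domain) :
    Equivalent r (p.prod q) := by
  refine peel_equivalent (2 * m) 2 (e : ℝ) r p q hrd (fun z hz => ?_) hpd (fun z hz => ?_) hqd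
    (fun w hw => ?_)
  · rw [hri hz]
    dsimp only
    rw [Real.rpow_natCast]
  · rw [hpi hz]
    dsimp only
    rw [show (e : ℝ) + ((2 : ℕ) : ℝ) / 2 = ((e + 1 : ℕ) : ℝ) by push_cast; ring, Real.rpow_natCast]
  · rw [hqi hw]
    dsimp only
    rw [Real.rpow_natCast]

/-- **Disc to square** (`n = d = 1`): for representations pinned as `r = [disc, (1 − |w|²)^e]`,
`p = [(−1,1), (1 − x²)^{e + 1/2}]`, `q = [(−1,1), (1 − s²)^e]`: `r ∼ p × q`, by ONE change of
variables `(x, s) ↦ (x, √(1 − x²) s)` from `(−1,1)²` onto the disc (`|det| = √(1 − x²)`).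
[cite: KontsevichZagier2001, §1.2 rule (2)] -/
theorem discToSquare_equivalent (e : ℕ) (r : IntegralRep 2) (p q : IntegralRep 1)
    (hrd : r.domain = {w | ∑ i, (w i) ^ 2 < 1})
    (hri : Set.EqOn r.integrand (fun w => (1 - ∑ i, (w i) ^ 2) ^ e) r.domain)
    (hpd : p.domain = {x | x 0 ∈ Set.Ioo (-1:ℝ) 1})
    (hpi : Set.EqOn p.integrand (fun x => (1 - (x 0) ^ 2) ^ ((e : ℝ) + 1 / 2)) p.domain)
    (hqd : q.domain = {x | x 0 ∈ Set.Ioo (-1:ℝ) 1})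
    (hqi : Set.EqOn q.integrand (fun x => (1 - (x 0) ^ 2) ^ e) q.domain) :
    Equivalent r (p.prod q) := by
  refine peel_equivalent 1 1 (e : ℝ) r p q hrd (fun z hz => ?_)
    (hpd.trans setOf_apply_mem_Ioo_eq_ball) (fun z hz => ?_)
    (hqd.trans setOf_apply_mem_Ioo_eq_ball) (fun w hw => ?_)
  · rw [hri hz]
    dsimp only
    rw [Real.rpow_natCast]
  · rw [hpi hz]
    simp only [Fin.sum_univ_one, Nat.cast_one]
  · rw [hqi hw]
    simp only [Fin.sum_univ_one, Real.rpow_natCast]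

end BallPeeling

end KZ

end Literature.NumberTheory.Transcendental
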